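import Summits.CriticalPhenomena.PercolationContinuityZ3.Theorems.PercNearOneGluingNoHeavyLowerTailSunflowerPartitionLemma
import HarnessLib
import HarnessLib.Audit

/-!
# `NoHeavyLowerTail` (crux stmt-CriticalPhenomena-4575), abstract sunflower cubic: PETAL-PROMOTION MONOTONICITY of the partition functional

Support file (seat `prim-ineq-prove-1` gen 25/26; `--supports stmt-CriticalPhenomena-4575`; companion of `…SunflowerAntipodalGladkov`,
`…SunflowerPartitionLemma`).  Memo: run/shared/lean/prim/prim-ineq-prove-1/ABSTRACT-SUNFLOWER-CUBIC-prove1-g25.md §8–§9.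

* `promote_kernel_ge_kk` / `demote_kernel_ge_kk` — the kernels of the moves petal → kernel and petal → bottom dominate the Gladkov kernel `kk`
  pointwise (`decide`); `promote_bottom_kernel` — bottom ↔ kernel has no sign.
* `Sunflower.promotion_sum_nonneg` / `Sunflower.demotion_sum_nonneg` — hence the corresponding antipodal sums are `≥ 0` by
  `Sunflower.antipodal_gladkov` (p214186).
* `Sunflower.promote` — the sunflower obtained by promoting to the kernel a set `K` all of whose proper supersets are kernel; `lab_promote`.
* `Sunflower.ZH_le_ZH_promote` — **petal promotion never decreases `ZH`**: if `K` is nonempty and petal-valued with all proper supersets kernel,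
  `F.ZH ≤ (F.promote K).ZH` (bookkeeping `sum_parts_fst/snd/thd_eq` over which block equals `K`, then `promotion_sum_nonneg` three times).
  Iterated along decreasing size this gives `ZH φ ≥ ZH φ_f` for petal-founded maps (companion `…SunflowerForcedReduction`), i.e. the reduction of the
  partition lemma `PartitionLemmaH` to the three-up-set form `ThreeUpsetPartitionIneq` (companion `…SunflowerPartitionReduction`).
-/

namespace Summit.CriticalPhenomena.PercolationContinuityZ3.Theorems.SunflowerPartition

open Finset

/-- Kernel of petal promotion dominates the Gladkov kernel: `kk y z ≤ s6H 4 y z − s6H i y z` for a petal value `i`. [this work] -/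
theorem promote_kernel_ge_kk : ∀ i y z : Fin 5, (i = 1 ∨ i = 2 ∨ i = 3) → kk y z ≤ s6H 4 y z - s6H i y z := by decide

/-- Kernel of petal DEMOTION to the bottom also dominates the Gladkov kernel: `kk y z ≤ s6H 0 y z − s6H i y z`. [this work] -/
theorem demote_kernel_ge_kk : ∀ i y z : Fin 5, (i = 1 ∨ i = 2 ∨ i = 3) → kk y z ≤ s6H 0 y z - s6H i y z := by decide

/-- … whereas bottom ↔ kernel has no sign: `s6H 4 y z − s6H 0 y z = 2[y = z = 0] − 2[y = z = 4]`. [this work] -/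
theorem promote_bottom_kernel : ∀ y z : Fin 5,
    s6H 4 y z - s6H 0 y z = (if y = 0 ∧ z = 0 then 2 else 0) - (if y = 4 ∧ z = 4 then 2 else 0) := by decide

variable {α : Type*} [Fintype α] [DecidableEq α]

namespace Sunflower

omit [Fintype α] in
/-- **Petal-promotion monotonicity (kernel level).**  For a petal value `i` and any `W`,
`0 ≤ Σ_{T ⊆ W} (s6H ⊤ (lab T) (lab (W ∖ T)) − s6H i (lab T) (lab (W ∖ T)))` — by `antipodal_gladkov` and `promote_kernel_ge_kk`.
This is `⅓` of the change of `ZH` when a petal-`i` set `K` with `Kᶜ = W` (all proper supersets kernel) is promoted to the kernel. [this work] -/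
theorem promotion_sum_nonneg (F : Sunflower α) (i : Fin 5) (hi : i = 1 ∨ i = 2 ∨ i = 3) (W : Finset α) :
    0 ≤ ∑ T ∈ W.powerset, (s6H 4 (F.lab T) (F.lab (W \ T)) - s6H i (F.lab T) (F.lab (W \ T))) :=
  le_trans (F.antipodal_gladkov W) (sum_le_sum fun _ _ => promote_kernel_ge_kk i _ _ hi)

omit [Fintype α] in
/-- **Petal-demotion monotonicity (kernel level)**: for a petal value `i` and any `W`,
`0 ≤ Σ_{T ⊆ W} (s6H 0 (lab T) (lab (W ∖ T)) − s6H i (lab T) (lab (W ∖ T)))` — demoting a minimal petal set to the bottom never decreases `ZH`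
(memo §9, move Wm). [this work] -/
theorem demotion_sum_nonneg (F : Sunflower α) (i : Fin 5) (hi : i = 1 ∨ i = 2 ∨ i = 3) (W : Finset α) :
    0 ≤ ∑ T ∈ W.powerset, (s6H 0 (F.lab T) (F.lab (W \ T)) - s6H i (F.lab T) (F.lab (W \ T))) :=
  le_trans (F.antipodal_gladkov W) (sum_le_sum fun _ _ => demote_kernel_ge_kk i _ _ hi)


/-! ### Petal promotion at the level of `ZH` -/

omit [Fintype α] in
/-- **Promotion** of a petal-valued set `K` all of whose proper supersets are kernel: add `K` to every `V i`. [this work] -/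
def promote (F : Sunflower α) (K : Finset α) (hsup : ∀ T : Finset α, K ⊂ T → T ∈ F.A) : Sunflower α where
  V := fun i => insert K (F.V i)
  upper := by
    intro i S T hST hS
    rw [Finset.mem_coe, mem_insert] at hS ⊢
    rcases hS with rfl | hS
    · by_cases h : T = S
      · exact Or.inl h
      · right
        have hlt : S ⊂ T := lt_of_le_of_ne hST (Ne.symm h)
        have hA := hsup T hlt
        unfold A at hA
        rw [mem_inter] at hA
        fin_cases i
        · exact hA.1
        · exact hA.2
        · have h02 := F.inter_eq 0 2 (by decide)
          have : T ∈ F.V 0 ∩ F.V 2 := by rw [h02]; exact mem_inter.2 hA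
          exact (mem_inter.1 this).2
    · exact Or.inr (F.upper i hST hS)
  inter_eq := by
    intro i j hij
    have h := F.inter_eq i j hij
    ext S
    simp only [mem_inter, mem_insert]
    constructor
    · rintro ⟨h1 | h1, h2 | h2⟩
      · exact ⟨Or.inl h1, Or.inl h1⟩
      · exact ⟨Or.inl h1, Or.inl h1⟩
      · exact ⟨Or.inl h2, Or.inl h2⟩
      · have : S ∈ F.V i ∩ F.V j := mem_inter.2 ⟨h1, h2⟩
        rw [h] at this
        exact ⟨Or.inr (mem_inter.1 this).1, Or.inr (mem_inter.1 this).2⟩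
    · rintro ⟨h1 | h1, h2 | h2⟩
      · exact ⟨Or.inl h1, Or.inl h1⟩
      · exact ⟨Or.inl h1, Or.inl h1⟩
      · exact ⟨Or.inl h2, Or.inl h2⟩
      · have : S ∈ F.V 0 ∩ F.V 1 := mem_inter.2 ⟨h1, h2⟩
        rw [← h] at this
        exact ⟨Or.inr (mem_inter.1 this).1, Or.inr (mem_inter.1 this).2⟩

omit [Fintype α] in
/-- The kernel of the promoted sunflower is `insert K A`. [this work] -/
theorem promote_A (F : Sunflower α) (K : Finset α) (hsup : ∀ T : Finset α, K ⊂ T → T ∈ F.A) :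
    (F.promote K hsup).A = insert K F.A := by
  unfold A promote
  ext S; simp only [mem_inter, mem_insert]; tauto

omit [Fintype α] in
/-- Labelling after promotion: `K ↦ ⊤`, everything else unchanged. [this work] -/
theorem lab_promote (F : Sunflower α) (K : Finset α) (hsup : ∀ T : Finset α, K ⊂ T → T ∈ F.A) (S : Finset α) :
    (F.promote K hsup).lab S = if S = K then 4 else F.lab S := by
  by_cases hS : S = K
  · subst hS
    have : S ∈ (F.promote S hsup).A := by rw [promote_A]; exact mem_insert_self _ _
    simp only [lab, this, if_true]
  · have hA : (S ∈ (F.promote K hsup).A) ↔ S ∈ F.A := by rw [promote_A, mem_insert]; simp [hS]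
    have hV : ∀ i, (S ∈ (F.promote K hsup).V i) ↔ S ∈ F.V i := by
      intro i; show S ∈ insert K (F.V i) ↔ _; rw [mem_insert]; simp [hS]
    simp only [lab, hS, if_false]
    simp only [hA, hV]

omit [Fintype α] [DecidableEq α] in
/-- In an ordered 3-partition at most one block can be a given nonempty set: the second block. [this work] -/
theorem snd_ne_of_fst_eq {K S T : Finset α} (hK : K.Nonempty) (hd : Disjoint S T) (hS : S = K) : T ≠ K := by
  rintro rfl; subst hS
  obtain ⟨x, hx⟩ := hK
  exact disjoint_left.1 hd hx hx

omit [DecidableEq α] in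
/-- … and the third block. [this work] -/
theorem compl_ne_of_fst_eq [DecidableEq α] {K S T : Finset α} (hK : K.Nonempty) (hS : S = K) : (S ∪ T)ᶜ ≠ K := by
  intro h; subst hS
  obtain ⟨x, hx⟩ := hK
  have : x ∈ (S ∪ T)ᶜ := by rw [h]; exact hx
  rw [mem_compl, mem_union] at this
  exact this (Or.inl hx)

omit [DecidableEq α] in
/-- … and the third block (from the second). [this work] -/
theorem compl_ne_of_snd_eq [DecidableEq α] {K S T : Finset α} (hK : K.Nonempty) (hT : T = K) : (S ∪ T)ᶜ ≠ K := by
  rw [union_comm]; exact compl_ne_of_fst_eq hK hT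

/-- The pointwise change of the summand under promotion, split by WHICH block equals `K`. [this work] -/
theorem promote_summand (F : Sunflower α) (K : Finset α) (hsup : ∀ T : Finset α, K ⊂ T → T ∈ F.A) (hK : K.Nonempty)
    {S T : Finset α} (hd : Disjoint S T) :
    s6H ((F.promote K hsup).lab S) ((F.promote K hsup).lab T) ((F.promote K hsup).lab (S ∪ T)ᶜ)
      - s6H (F.lab S) (F.lab T) (F.lab (S ∪ T)ᶜ)
      = (if S = K then s6H 4 (F.lab T) (F.lab (S ∪ T)ᶜ) - s6H (F.lab K) (F.lab T) (F.lab (S ∪ T)ᶜ) else 0)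
        + (if T = K then s6H (F.lab S) 4 (F.lab (S ∪ T)ᶜ) - s6H (F.lab S) (F.lab K) (F.lab (S ∪ T)ᶜ) else 0)
        + (if (S ∪ T)ᶜ = K then s6H (F.lab S) (F.lab T) 4 - s6H (F.lab S) (F.lab T) (F.lab K) else 0) := by
  rw [lab_promote, lab_promote, lab_promote]
  by_cases h1 : S = K
  · have h2 : T ≠ K := snd_ne_of_fst_eq hK hd h1
    have h3 : (S ∪ T)ᶜ ≠ K := compl_ne_of_fst_eq hK h1
    rw [if_pos h1, if_neg h2, if_neg h3, if_pos h1, if_neg h2, if_neg h3, h1]; ring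
  by_cases h2 : T = K
  · have h3 : (S ∪ T)ᶜ ≠ K := compl_ne_of_snd_eq hK h2
    rw [if_neg h1, if_pos h2, if_neg h3, if_neg h1, if_pos h2, if_neg h3, h2]; ring
  by_cases h3 : (S ∪ T)ᶜ = K
  · rw [if_neg h1, if_neg h2, if_pos h3, if_neg h1, if_neg h2, if_pos h3, h3]; ring
  · rw [if_neg h1, if_neg h2, if_neg h3, if_neg h1, if_neg h2, if_neg h3]; ring

/-- Sum over partitions with FIRST block `K`. [this work] -/
theorem sum_parts_fst_eq (K : Finset α) (f : Finset α → Finset α → ℤ) :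
    ∑ q ∈ parts α, (if q.1 = K then f q.2 (q.1 ∪ q.2)ᶜ else 0) = ∑ T ∈ (Kᶜ).powerset, f T (K ∪ T)ᶜ := by
  rw [sum_parts_eq (f := fun S T => if S = K then f T (S ∪ T)ᶜ else 0)]
  rw [Finset.sum_eq_single K]
  · simp only [if_true]
  · intro S _ hS; simp only [hS, if_false, sum_const_zero]
  · intro h; exact absurd (mem_univ K) h

/-- Sum over partitions with SECOND block `K`. [this work] -/
theorem sum_parts_snd_eq (K : Finset α) (f : Finset α → Finset α → ℤ) :
    ∑ q ∈ parts α, (if q.2 = K then f q.1 (q.1 ∪ q.2)ᶜ else 0) = ∑ S ∈ (Kᶜ).powerset, f S (S ∪ K)ᶜ := by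
  rw [sum_parts_eq (f := fun S T => if T = K then f S (S ∪ T)ᶜ else 0)]
  have key : ∀ S : Finset α, (∑ T ∈ (Sᶜ).powerset, if T = K then f S (S ∪ T)ᶜ else 0)
      = if S ∈ (Kᶜ).powerset then f S (S ∪ K)ᶜ else 0 := by
    intro S
    by_cases hSK : K ∈ (Sᶜ).powerset
    · rw [Finset.sum_eq_single K]
      · have : S ∈ (Kᶜ).powerset := by
          rw [mem_powerset] at hSK ⊢; rw [subset_compl_comm]; exact hSK
        simp only [if_true, this]
      · intro T _ hT; simp only [hT, if_false]
      · intro h; exact absurd hSK h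
    · have hz : (∑ T ∈ (Sᶜ).powerset, if T = K then f S (S ∪ T)ᶜ else 0) = 0 := by
        apply Finset.sum_eq_zero; intro T hT; by_cases h : T = K
        · subst h; exact absurd hT hSK
        · simp [h]
      have : S ∉ (Kᶜ).powerset := by
        rw [mem_powerset] at hSK ⊢; rw [subset_compl_comm]; exact hSK
      rw [hz]; simp only [this, if_false]
  rw [Finset.sum_congr rfl fun S _ => key S, ← Finset.sum_filter]
  congr 1; ext S; simp

/-- Sum over partitions with THIRD block `K`. [this work] -/
theorem sum_parts_thd_eq (K : Finset α) (f : Finset α → Finset α → ℤ) :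
    ∑ q ∈ parts α, (if (q.1 ∪ q.2)ᶜ = K then f q.1 q.2 else 0) = ∑ S ∈ (Kᶜ).powerset, f S (Kᶜ \ S) := by
  rw [sum_parts_eq (f := fun S T => if (S ∪ T)ᶜ = K then f S T else 0)]
  have key : ∀ S : Finset α, (∑ T ∈ (Sᶜ).powerset, if (S ∪ T)ᶜ = K then f S T else 0)
      = if S ∈ (Kᶜ).powerset then f S (Kᶜ \ S) else 0 := by
    intro S
    by_cases hS : S ∈ (Kᶜ).powerset
    · have hSK : S ⊆ Kᶜ := mem_powerset.1 hS
      have hU : S ∪ (Kᶜ \ S) = Kᶜ := union_sdiff_of_subset hSK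
      have hT0 : Kᶜ \ S ∈ (Sᶜ).powerset := by
        rw [mem_powerset, subset_compl_iff_disjoint_left]; exact disjoint_sdiff
      rw [sum_eq_single (Kᶜ \ S)]
      · rw [hU, compl_compl, if_pos rfl, if_pos hS]
      · intro T hT hne
        have hne' : (S ∪ T)ᶜ ≠ K := by
          intro h
          apply hne
          have hST : S ∪ T = Kᶜ := by rw [← h, compl_compl]
          have hdis : Disjoint S T := subset_compl_iff_disjoint_left.1 (mem_powerset.1 hT)
          rw [← union_sdiff_cancel_left hdis, hST]
        rw [if_neg hne']
      · intro h; exact absurd hT0 h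
    · have hne : ∀ T ∈ (Sᶜ).powerset, (S ∪ T)ᶜ ≠ K := by
        intro T _ h
        apply hS; rw [mem_powerset]; intro x hx; rw [mem_compl]; intro hxK
        rw [← h, mem_compl, mem_union] at hxK; exact hxK (Or.inl hx)
      rw [sum_eq_zero (fun T hT => by rw [if_neg (hne T hT)]), if_neg hS]
  rw [Finset.sum_congr rfl fun S _ => key S, ← Finset.sum_filter]
  congr 1; ext S; simp

/-- **PETAL PROMOTION NEVER DECREASES `ZH`** (this work): if `K` is nonempty, petal-valued, and all its proper supersets are kernel, then
`(F.promote K).ZH ≥ F.ZH`.  (Iterated along decreasing size this gives `ZH φ ≥ ZH φ_f` for petal-founded maps, memo §8.) [this work] -/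
theorem ZH_le_ZH_promote (F : Sunflower α) (K : Finset α) (hsup : ∀ T : Finset α, K ⊂ T → T ∈ F.A) (hK : K.Nonempty)
    (hpet : F.lab K = 1 ∨ F.lab K = 2 ∨ F.lab K = 3) : F.ZH ≤ (F.promote K hsup).ZH := by
  rw [← sub_nonneg]
  unfold ZH
  rw [← sum_sub_distrib]
  have hq : ∀ q ∈ parts α, Disjoint q.1 q.2 := fun q hq => (mem_filter.1 hq).2
  rw [sum_congr rfl fun q hqq => F.promote_summand K hsup hK (hq q hqq)]
  rw [sum_add_distrib, sum_add_distrib]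
  rw [sum_parts_fst_eq K (fun T R => s6H 4 (F.lab T) (F.lab R) - s6H (F.lab K) (F.lab T) (F.lab R)),
    sum_parts_snd_eq K (fun S R => s6H (F.lab S) 4 (F.lab R) - s6H (F.lab S) (F.lab K) (F.lab R)),
    sum_parts_thd_eq K (fun S T => s6H (F.lab S) (F.lab T) 4 - s6H (F.lab S) (F.lab T) (F.lab K))]
  have e1 : ∀ T ∈ (Kᶜ).powerset, (K ∪ T)ᶜ = Kᶜ \ T := by
    intro T _; rw [compl_union, sdiff_eq_inter_compl]
  have e2 : ∀ S ∈ (Kᶜ).powerset, (S ∪ K)ᶜ = Kᶜ \ S := by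
    intro S _; rw [compl_union, sdiff_eq_inter_compl, inter_comm]
  have s1 := F.promotion_sum_nonneg (F.lab K) hpet Kᶜ
  have s2 : 0 ≤ ∑ S ∈ (Kᶜ).powerset, (s6H (F.lab S) 4 (F.lab (S ∪ K)ᶜ) - s6H (F.lab S) (F.lab K) (F.lab (S ∪ K)ᶜ)) := by
    refine le_of_le_of_eq s1 (sum_congr rfl fun S hS => ?_)
    rw [e2 S hS, (s6H_symm 4 (F.lab S) _).1, (s6H_symm (F.lab K) (F.lab S) _).1]
  have s1' : 0 ≤ ∑ T ∈ (Kᶜ).powerset, (s6H 4 (F.lab T) (F.lab (K ∪ T)ᶜ) - s6H (F.lab K) (F.lab T) (F.lab (K ∪ T)ᶜ)) := by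
    refine le_of_le_of_eq s1 (sum_congr rfl fun T hT => ?_); rw [e1 T hT]
  have s3 : 0 ≤ ∑ S ∈ (Kᶜ).powerset, (s6H (F.lab S) (F.lab (Kᶜ \ S)) 4 - s6H (F.lab S) (F.lab (Kᶜ \ S)) (F.lab K)) := by
    refine le_of_le_of_eq s1 (sum_congr rfl fun S _ => ?_)
    have c1 : ∀ a b c : Fin 5, s6H a b c = s6H b c a := by decide
    rw [← c1 4, ← c1 (F.lab K)]
  linarith

end Sunflower

end Summit.CriticalPhenomena.PercolationContinuityZ3.Theorems.SunflowerPartition
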